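import Summits.QuantumFields.BalabanUV.Beta.FP.KernelPeriodisationFibTraceTwoBound

/-!
# `BalabanUV.Beta.NVertexWoundLimit` — row D1 ∕ (C1), PART 15a: **THE TORUS TADPOLE TRACE IS BOUNDED BY THE INSERTION's CONSTANT, UNIFORMLY IN THE BOX AND IN
# THE LOCALISATION POINTS; THE WINDING TAIL IS ONE GEOMETRIC SERIES** — the two analytic bricks of the winding-limit lemma that (R1) «wound rows» adds to the
# law's B → ∞ step (an2 g67 J-NOTE-7 ∕ J-NOTE-8, journal l.67681 ∕ l.67705; road FP A-1 to J-NOTE-7 l.67696)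

WHY.  Under (R1) the second-order torus rows carry the WOUND family `Σ'_d 𝒲 μ 0 ν (z + M′_k∘d)`; its `d`-th term is bi-localised at `(p, N•z + T_k∘d)` with a
constant `Cw·e^{−δs|N•z + T_k∘d − p|}` (the SEPARATION-DECAY letter of J-NOTE-8).  leaf-06's de-periodisation (`KernelPeriodisationFibHessKer.tendsto_trace_tadpole`)
handles `d = 0`; the `d ≠ 0` terms need (a) a bound of the torus tadpole trace `|trace (perF M A * perF M (dper M V))|` by `K·C_V` with `K` INDEPENDENT of the
box `M` and of `V`'s localisation points (leaf-06's `abs_trace_tadpole_sub_tr_le` carries `e^{+(γ∕4)|p′−q′|}`, useless for far-apart points) — §1 — and (b) the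
geometric tail, termwise `e^{−δs|x + T∘d − p|} ≤ e^{δs|x−p|}·e^{−(δs∕2)N}·e^{−(δs∕2)|T∘d|}` once all periods are `≥ N` — §2.  The `tsum` exchanges that
assemble the limit (trace ∘ wound sum = wound sum ∘ trace, the tail summed against `Zl`) are PART 15b.

WHAT ([folklore] BY NAME over leaf-06's `trSh ∕ trace_perF_dper ∕ summable_expPair ∕ perF_mul_perF_dper ∕ biLoc_leg_comp ∕ le_l1_Mmul`; generic fibre `F`,
dimension `d`; no `def`, no `def … : Prop`, nothing cited, 0 sorry): §1 `abs_trSh_le_tsum_pair`, `tsum_abs_trSh_le`, **`abs_trace_perF_dper_le`**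
(`|trace (perF M (dper M Y))| ≤ |F|·C·Zl(γ∕2)·K_{d+1}(γ∕2)` for `BiLoc Y p q C γ` — uniform in `M, p, q`), **`abs_trace_tadpole_le_const`**
(`|trace (perF M A * perF M (dper M V))| ≤ 𝒦(A) · C_V`, `𝒦(A) = |F|·(|F|·CA·Zl(γ∕2))·Zl(γ∕4)·K_{d+1}(γ∕4)`, `γ = min α δV`); §2 `exp_neg_l1_translate_le_of_ne_zero`
(for `m ≠ 0` and periods `≥ N`: `e^{−δs|x + M∘m − p|} ≤ e^{δs|x − p|}·e^{−(δs∕2)N}·e^{−(δs∕2)|M∘m|}` — the termwise winding-tail bound; its sum over `m ≠ 0`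
against `Zl` is taken in PART 15b with the `tsum` exchanges).
WHAT THIS IS NOT: not the limit statement itself (PART 15b: the `tsum` exchanges + leaf-06's ε-step `tendsto_of_wrapAround`); not the separation-decay letter's
discharge for `W2OfK` (lit `SecondOrderResponse` sequel); no row of the END wrapper discharged; nothing of Bałaban's asserted, valued or discharged; 0 estimates
beyond [folklore] geometric series; 0∕4 row-D1 binders (hW, hR, D1Tel, D1Rep); ROOT M‴ p325680 ∕ P5c ∕ D6 untouched; NOT (C1), NOT D1, NEVER «G-an2-4 closed»,
NOT BetaPertH, NOT continuum, NOT Clay.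

HONEST DEPENDENCY (page 1, mandatory): continuum YM on T⁴ ⇐ BetaPertH ∧ nine spine estimates (0/9 proved); BetaPertH ⇐ (D1) ∧ (D4) ∧ CAP+tail;
G-an2-4 gates asym, D1 and NE2/3/4.  HONEST FRAMING (cell contract, verbatim): «discharging `BetaPertH` makes Bałaban's UV stability UNCONDITIONAL —
a real constructive-QFT result; it is NOT the continuum limit and NOT the Clay problem.»  ABSOLUTE RULE (cell charter, verbatim): «No internally-minted
statement may enter as a cited fact. Every hypothesis is either kernel-proved in this package or a verbatim quotation of a PUBLISHED theorem with page
reference. The manuscript(s) under audit are NOT citable for their own disputed steps — they are the thing under adjudication; programme-internal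
(2001/route/tribunal) claims are never citable.»  Row D1 ∕ (C1) OWNER an2 (b2b-balaban-beta-an2) gen 67, 2026-08-27.  No existing file touched.
-/

noncomputable section

open scoped BigOperators Matrix Topology
open Finset Filter

namespace Summit.QuantumFields.BalabanUV.Beta.NVertexWoundLimit

open Literature.MathematicalPhysics.QuantumFieldTheory.Balaban1983to89
open Literature.MathematicalPhysics.QuantumFieldTheory.Balaban1983to89.Beta
open B12Sec2to5 (l1 l1_nonneg)
open B4TorusKernel.MultiPeriod (translate translate_apply)
open B4Sect5Proof (latticeConst latticeConst_nonneg)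
open ExpKernelCalculus (MKer Decays BiLoc tr shiftK Zl Zl_nonneg l1_sub_symm tsum_exp_shift' summable_exp_shift')
open OneStepResolventKernel (biLoc_mono decays_mono)
open Summit.QuantumFields.BalabanUV.Beta.FP.KernelPeriodisationFib (perF translate_eq_add)
open Summit.QuantumFields.BalabanUV.Beta.FP.KernelPeriodisationFibLoc (dper)
open Summit.QuantumFields.BalabanUV.Beta.FP.KernelPeriodisationFibTrace (trSh trSh_eq_sum_tsum trace_perF_dper summable_expPair le_l1_Mmul translate_sub_self
  summable_uncurry_sites_lattice)
open Summit.QuantumFields.BalabanUV.Beta.FP.KernelPeriodisationFibTraceTwoBound (biLoc_leg_comp perF_mul_perF_dper)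

variable {d : ℕ} {F : Type*} [Fintype F] (M : Fin (d + 1) → ℕ) [∀ μ, NeZero (M μ)]

/-! ## §1 The torus trace of a periodised bi-localised kernel: a bound UNIFORM in the box and in the localisation points -/

section Mass

variable {Y : MKer (d + 1) F} {p q : Fin (d + 1) → ℤ} {C γ : ℝ}

/-- [folklore] one shifted diagonal trace is dominated by the explicit pair family of leaf-06's `summable_expPair` (rate halved):
`|trSh M Y m| ≤ |F|·C·Σ'_x e^{−(γ∕2)|x−p|}·e^{−(γ∕2)|x+M∘m−q|}`. -/
theorem abs_trSh_le_tsum_pair (hY : BiLoc Y p q C γ) (hC : 0 ≤ C) (hγ : 0 < γ) (m : Fin (d + 1) → ℤ) :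
    |trSh M Y m| ≤ (Fintype.card F : ℝ) * C *
      ∑' x : Fin (d + 1) → ℤ, Real.exp (-(γ / 2) * l1 (x - p)) * Real.exp (-(γ / 2) * l1 (translate M x m - q)) := by
  have hpair := (summable_expPair M hγ p q).1.prod_symm.prod_factor m
  rw [trSh_eq_sum_tsum M hY hC hγ m]
  have hterm : ∀ (a : F) (x : Fin (d + 1) → ℤ), ‖Y x (translate M x m) a a‖
      ≤ C * (Real.exp (-(γ / 2) * l1 (x - p)) * Real.exp (-(γ / 2) * l1 (translate M x m - q))) := fun a x => by
    rw [Real.norm_eq_abs]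
    refine (hY x (translate M x m) a a).trans ?_
    rw [← Real.exp_add]
    refine mul_le_mul_of_nonneg_left (Real.exp_le_exp.2 ?_) hC
    nlinarith [l1_nonneg (x - p), l1_nonneg (translate M x m - q), hγ.le]
  have hone : ∀ a : F, |∑' x : Fin (d + 1) → ℤ, Y x (translate M x m) a a|
      ≤ C * ∑' x : Fin (d + 1) → ℤ, Real.exp (-(γ / 2) * l1 (x - p)) * Real.exp (-(γ / 2) * l1 (translate M x m - q)) := fun a => by
    have h := tsum_of_norm_bounded ((hpair.mul_left C)).hasSum (hterm a)
    rw [tsum_mul_left] at h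
    exact (Real.norm_eq_abs _).symm.trans_le h
  calc |∑ a : F, ∑' x : Fin (d + 1) → ℤ, Y x (translate M x m) a a|
      ≤ ∑ a : F, |∑' x : Fin (d + 1) → ℤ, Y x (translate M x m) a a| := Finset.abs_sum_le_sum_abs _ _
    _ ≤ ∑ _a : F, C * ∑' x : Fin (d + 1) → ℤ, Real.exp (-(γ / 2) * l1 (x - p)) * Real.exp (-(γ / 2) * l1 (translate M x m - q)) :=
        Finset.sum_le_sum fun a _ => hone a
    _ = (Fintype.card F : ℝ) * C * ∑' x : Fin (d + 1) → ℤ, Real.exp (-(γ / 2) * l1 (x - p)) * Real.exp (-(γ / 2) * l1 (translate M x m - q)) := by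
        rw [Finset.sum_const, Finset.card_univ, nsmul_eq_mul, mul_assoc]

/-- [folklore] **the shifted diagonal traces are absolutely summable over the period lattice, total `≤ |F|·C·Zl(γ∕2)·K_{d+1}(γ∕2)`** — NO dependence on the box or on
the localisation points (only the pair family's total enters). -/
theorem tsum_abs_trSh_le (hY : BiLoc Y p q C γ) (hC : 0 ≤ C) (hγ : 0 < γ) :
    Summable (fun m : Fin (d + 1) → ℤ => |trSh M Y m|) ∧
      ∑' m : Fin (d + 1) → ℤ, |trSh M Y m| ≤ (Fintype.card F : ℝ) * C * (Zl (d + 1) (γ / 2) * latticeConst (d + 1) (γ / 2)) := by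
  obtain ⟨hprod, hle⟩ := summable_expPair M hγ p q
  have hrow : Summable fun m : Fin (d + 1) → ℤ => ∑' x : Fin (d + 1) → ℤ,
      Real.exp (-(γ / 2) * l1 (x - p)) * Real.exp (-(γ / 2) * l1 (translate M x m - q)) := hprod.prod_symm.prod
  have hmaj : Summable fun m : Fin (d + 1) → ℤ => (Fintype.card F : ℝ) * C *
      ∑' x : Fin (d + 1) → ℤ, Real.exp (-(γ / 2) * l1 (x - p)) * Real.exp (-(γ / 2) * l1 (translate M x m - q)) := hrow.mul_left _
  have hs : Summable (fun m : Fin (d + 1) → ℤ => |trSh M Y m|) :=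
    hmaj.of_nonneg_of_le (fun m => abs_nonneg _) fun m => abs_trSh_le_tsum_pair M hY hC hγ m
  refine ⟨hs, ?_⟩
  calc ∑' m : Fin (d + 1) → ℤ, |trSh M Y m|
      ≤ ∑' m : Fin (d + 1) → ℤ, (Fintype.card F : ℝ) * C *
          ∑' x : Fin (d + 1) → ℤ, Real.exp (-(γ / 2) * l1 (x - p)) * Real.exp (-(γ / 2) * l1 (translate M x m - q)) :=
        hs.tsum_le_tsum (fun m => abs_trSh_le_tsum_pair M hY hC hγ m) hmaj
    _ = (Fintype.card F : ℝ) * C * ∑' m : Fin (d + 1) → ℤ, ∑' x : Fin (d + 1) → ℤ,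
          Real.exp (-(γ / 2) * l1 (x - p)) * Real.exp (-(γ / 2) * l1 (translate M x m - q)) := tsum_mul_left
    _ ≤ (Fintype.card F : ℝ) * C * (Zl (d + 1) (γ / 2) * latticeConst (d + 1) (γ / 2)) := by
        refine mul_le_mul_of_nonneg_left ?_ (mul_nonneg (Nat.cast_nonneg _) hC)
        have h1 : ∑' (m : Fin (d + 1) → ℤ) (x : Fin (d + 1) → ℤ),
              Real.exp (-(γ / 2) * l1 (x - p)) * Real.exp (-(γ / 2) * l1 (translate M x m - q))
            = ∑' (x : Fin (d + 1) → ℤ) (m : Fin (d + 1) → ℤ),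
              Real.exp (-(γ / 2) * l1 (x - p)) * Real.exp (-(γ / 2) * l1 (translate M x m - q)) :=
          Summable.tsum_comm (f := fun x m => Real.exp (-(γ / 2) * l1 (x - p)) * Real.exp (-(γ / 2) * l1 (translate M x m - q))) hprod
        have h2 : ∑' (x : Fin (d + 1) → ℤ) (m : Fin (d + 1) → ℤ),
              Real.exp (-(γ / 2) * l1 (x - p)) * Real.exp (-(γ / 2) * l1 (translate M x m - q))
            = ∑' xm : (Fin (d + 1) → ℤ) × (Fin (d + 1) → ℤ),
              Real.exp (-(γ / 2) * l1 (xm.1 - p)) * Real.exp (-(γ / 2) * l1 (translate M xm.1 xm.2 - q)) :=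
          hprod.tsum_prod.symm
        rw [h1, h2]
        exact hle

/-- [folklore] **`abs_trace_perF_dper_le` — THE TORUS TRACE OF A PERIODISED BI-LOCALISED KERNEL IS BOUNDED BY ITS CONSTANT**, uniformly in the box and in the
localisation points: `|trace (perF M (dper M Y))| ≤ |F|·C·Zl(γ∕2)·K_{d+1}(γ∕2)` (leaf-06's `trace_perF_dper` + §1). -/
theorem abs_trace_perF_dper_le (hY : BiLoc Y p q C γ) (hC : 0 ≤ C) (hγ : 0 < γ) :
    |Matrix.trace (perF M (dper M Y))| ≤ (Fintype.card F : ℝ) * C * (Zl (d + 1) (γ / 2) * latticeConst (d + 1) (γ / 2)) := by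
  obtain ⟨hs, hle⟩ := tsum_abs_trSh_le M hY hC hγ
  rw [trace_perF_dper M hY hγ]
  refine le_trans ?_ hle
  have h := norm_tsum_le_tsum_norm (f := fun m : Fin (d + 1) → ℤ => trSh M Y m) (by simpa only [Real.norm_eq_abs] using hs)
  simpa only [Real.norm_eq_abs] using h

variable {A V : MKer (d + 1) F} {CA CV α δV : ℝ} {p' q' : Fin (d + 1) → ℤ}

/-- [folklore] **`abs_trace_tadpole_le_const` — THE TORUS TADPOLE TRACE IS BOUNDED BY THE INSERTION's CONSTANT**: for an `Mℤ`-invariant decaying leg `A` and a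
bi-localised `V`, `|trace (perF M A * perF M (dper M V))| ≤ 𝒦 · C_V` with `𝒦 = |F|·(|F|·CA·Zl(γ − γ∕2))·Zl(γ∕4)·K_{d+1}(γ∕4)`, `γ = min α δV` — INDEPENDENT of the box
`M` and of `V`'s localisation points `(p′, q′)` (leaf-06's `perF_mul_perF_dper` + `biLoc_leg_comp` + `abs_trace_perF_dper_le`).  The brick that makes the
winding tail of a wound family small termwise. -/
theorem abs_trace_tadpole_le_const (hA : Decays A CA α) (hα : 0 < α)
    (hAinv : ∀ (m x y : Fin (d + 1) → ℤ) (a b : F), A (translate M x m) (translate M y m) a b = A x y a b)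
    (hV : BiLoc V p' q' CV δV) (hCV : 0 ≤ CV) (hδV : 0 < δV) :
    |Matrix.trace (perF M A * perF M (dper M V))|
      ≤ (Fintype.card F : ℝ) * ((Fintype.card F : ℝ) * (CA * CV) * Zl (d + 1) (min α δV - min α δV / 2))
          * (Zl (d + 1) (min α δV / 2 / 2) * latticeConst (d + 1) (min α δV / 2 / 2)) := by
  rcases isEmpty_or_nonempty F with hF | ⟨⟨a₀⟩⟩
  · have h0 : Matrix.trace (perF M A * perF M (dper M V)) = 0 := by
      rw [Matrix.trace]; simp [Finset.univ_eq_empty]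
    rw [h0, abs_zero]
    simp
  have hCA : 0 ≤ CA := hA.nonneg a₀
  have hγ : 0 < min α δV := lt_min hα hδV
  have h1 := biLoc_leg_comp hA hV hCA hCV hα hδV
  rw [perF_mul_perF_dper M hA hα hAinv hV hCV hδV]
  have h0 : 0 ≤ (Fintype.card F : ℝ) * (CA * CV) * Zl (d + 1) (min α δV - min α δV / 2) :=
    mul_nonneg (mul_nonneg (Nat.cast_nonneg _) (mul_nonneg hCA hCV)) (Zl_nonneg (by linarith))
  exact abs_trace_perF_dper_le M h1 h0 (half_pos hγ)

end Mass

/-! ## §2 The winding tail: one geometric series -/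

section Tail

variable {δs : ℝ}

omit [∀ μ, NeZero (M μ)] in
/-- [folklore] for a NONZERO winding `m` and periods all `≥ N`: `e^{−δs|x + M∘m − p|} ≤ e^{δs|x − p|}·e^{−(δs∕2)·N}·e^{−(δs∕2)|M∘m|}` (triangle inequality
`|x + M∘m − p| ≥ |M∘m| − |x − p|`, and `|M∘m|₁ ≥ N` by leaf-06's `le_l1_Mmul`). -/
theorem exp_neg_l1_translate_le_of_ne_zero (hδs : 0 ≤ δs) {N : ℕ} (hMN : ∀ i, N ≤ M i) (x p : Fin (d + 1) → ℤ)
    {m : Fin (d + 1) → ℤ} (hm : m ≠ 0) :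
    Real.exp (-δs * l1 (translate M x m - p))
      ≤ Real.exp (δs * l1 (x - p)) * Real.exp (-(δs / 2) * N) * Real.exp (-(δs / 2) * l1 (fun i => (M i : ℤ) * m i)) := by
  rw [← Real.exp_add, ← Real.exp_add]
  refine Real.exp_le_exp.2 ?_
  have hN : (N : ℝ) ≤ l1 (fun i => (M i : ℤ) * m i) := le_l1_Mmul M hMN hm
  -- `|M∘m| ≤ |x + M∘m − p| + |x − p|`
  have htri : l1 (fun i => (M i : ℤ) * m i) ≤ l1 (translate M x m - p) + l1 (x - p) := by
    rw [← translate_sub_self M x m, l1_sub_symm x p]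
    exact ExpKernelCalculus.l1_sub_triangle (translate M x m) p x
  nlinarith [l1_nonneg (translate M x m - p), l1_nonneg (x - p), l1_nonneg (fun i => (M i : ℤ) * m i)]

end Tail

end Summit.QuantumFields.BalabanUV.Beta.NVertexWoundLimit

end
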